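import Summits.Ventures.PercRepro.Night2LocalOne
import Summits.Ventures.PercRepro.Night2LocalCoverExtra

/-!
# PercRepro — extra sets of the (C2) matching and their preimages (night-2, gen 7)

Support for case (C2) of the paper proof of `ShadowHall M 4 2` (`proofs/NIGHT-2-local.md` §8, corrected in §13):
`G` a rank-`(q + 1)` flat with exactly ONE ground element outside it.  A member `B` inside `G` with
`|G ∖ cl B| = 2` has the EXTRA SET `B ∪ (G ∖ cl B)`, a shadow set with closure `G` (`extra_mem_shadowAt`).

* `card_compl_clF_of_card_compl_one`: `|E ∖ cl B| = |G ∖ cl B| + 1`;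
* **`coverPreimages_eq_empty_of_extra`** (L1): a set which is the extra set of some member has NO covering
  preimage — a covering preimage `S ∖ {z₁}` would have its complement inside `{w} ∪ cl B` (rank `≤ q + 1`) or
  would contain `B ∪ {b}` of rank `q + 1`;
The bound on the number of members sharing an extra set is in `Night2LocalExtraThree.lean`.
-/

namespace PercRepro.Shadow

open Finset PerFlat ThmH

variable {α : Type*} [DecidableEq α] {M : Matroid α} [M.Finite]

/-! ## One element outside `G` -/

/-- With exactly one ground element outside `G`, a member inside `G` has `|E ∖ cl B| = |G ∖ cl B| + 1`. -/
theorem card_compl_clF_of_card_compl_one {q : ℕ} {G : Finset α} (hG : G ∈ flatsQ M (q + 1))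
    (hd : (gr M \ G).card = 1) {B : Finset α} (hBG : clF M B ⊆ G) :
    (gr M \ clF M B).card = (G \ clF M B).card + 1 := by
  have hGg : G ⊆ gr M := (mem_flatsQ.1 hG).1
  have hu : gr M \ G ∪ G \ clF M B = gr M \ clF M B := Finset.sdiff_union_sdiff_cancel hGg hBG
  have hdisj : Disjoint (gr M \ G) (G \ clF M B) := by
    rw [Finset.disjoint_left]
    intro x hx hx'
    exact (Finset.mem_sdiff.1 hx).2 (Finset.mem_sdiff.1 hx').1
  rw [← hu, Finset.card_union_eq_card_add_card.2 hdisj, hd]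
  ring

/-- The extra set `B ∪ (G ∖ cl B)` of a member inside `G` is a shadow set with closure `G` (when `G ∖ cl B` is
nonempty). -/
theorem extra_mem_shadowAt {q : ℕ} {𝒜 : Finset (Finset α)} (h𝒜 : 𝒜 ⊆ Uq M (q + 2) q) {G : Finset α}
    (hG : G ∈ flatsQ M (q + 1)) {B : Finset α} (hB : B ∈ membersIn M 𝒜 G) (hne : (G \ clF M B).Nonempty) :
    B ∪ (G \ clF M B) ∈ shadowAt M (q + 2) q 𝒜 G := by
  obtain ⟨z, hz⟩ := hne
  have hBU : B ∈ Uq M (q + 2) q := h𝒜 (mem_membersIn.1 hB).1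
  have hBG : clF M B ⊆ G := (mem_membersIn.1 hB).2
  have hGg : G ⊆ gr M := (mem_flatsQ.1 hG).1
  have hins := insert_mem_shadowAt h𝒜 hG hB hz
  rw [mem_shadowAt] at hins ⊢
  have hsub : insert z B ⊆ B ∪ (G \ clF M B) := by
    intro x hx
    rw [Finset.mem_insert] at hx
    rcases hx with rfl | hx
    · exact Finset.mem_union_right _ hz
    · exact Finset.mem_union_left _ hx
  have hsubG : B ∪ (G \ clF M B) ⊆ G := by
    intro x hx
    rw [Finset.mem_union] at hx
    rcases hx with hx | hx
    · exact hBG (subset_clF hBU hx)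
    · exact (Finset.mem_sdiff.1 hx).1
  -- rank q + 1: between insert z B (rank q + 1) and G (rank q + 1)
  have hr1 : M.eRk ((insert z B : Finset α) : Set α) = ((q + 1 : ℕ) : ℕ∞) :=
    eRk_eq_of_mem_Yq_diag (shadow_subset_Yq _ hins.1)
  have hr : M.eRk ((B ∪ (G \ clF M B) : Finset α) : Set α) = ((q + 1 : ℕ) : ℕ∞) := by
    apply le_antisymm
    · rw [← (mem_flatsQ.1 hG).2.2]
      exact M.eRk_mono (by exact_mod_cast hsubG)
    · rw [← hr1]
      exact M.eRk_mono (by exact_mod_cast hsub)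
  have hY : B ∪ (G \ clF M B) ∈ Yq M (q + 2) q := by
    unfold Yq
    rw [Finset.mem_filter, Finset.mem_powerset, hr]
    refine ⟨hsubG.trans hGg, ?_, ?_⟩
    · exact_mod_cast Nat.lt_succ_self q
    · exact_mod_cast Nat.lt_succ_self (q + 1)
  refine ⟨?_, ?_⟩
  · rw [mem_shadow]
    exact ⟨hY, B, (mem_membersIn.1 hB).1, Finset.subset_union_left⟩
  · have hclsub : clF M (B ∪ (G \ clF M B)) ⊆ G := by
      rw [← Finset.coe_subset, coe_clF]
      exact (M.closure_subset_closure (by exact_mod_cast hsubG)).trans (mem_flatsQ.1 hG).2.1.closure.subset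
    exact flat_eq_of_subset_of_eRk_eq hG (by rw [coe_clF]; exact M.isFlat_closure _) hclsub
      (by rw [coe_clF, M.eRk_closure_eq]; exact hr)


/-! ## The extra sets and their preimages -/

/-- The extra sets of `B` at `G`: the single set `B ∪ (G ∖ cl B)` when `|G ∖ cl B| = 2`, nothing otherwise. -/
noncomputable def extraSets (M : Matroid α) [M.Finite] (G B : Finset α) : Finset (Finset α) :=
  if (G \ clF M B).card = 2 then {B ∪ (G \ clF M B)} else ∅

/-- Membership in `extraSets`. -/
theorem mem_extraSets {G B S : Finset α} :
    S ∈ extraSets M G B ↔ (G \ clF M B).card = 2 ∧ S = B ∪ (G \ clF M B) := by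
  unfold extraSets
  split_ifs with h
  · rw [Finset.mem_singleton]
    exact ⟨fun h' => ⟨h, h'⟩, fun h' => h'.2⟩
  · simp only [Finset.notMem_empty, false_iff, not_and]
    intro h'
    exact absurd h' h

/-- A bottom set cannot have its complement inside a set of rank `≤ q + 1`. -/
theorem false_of_compl_subset {q : ℕ} {B : Finset α} (hB : B ∈ Uq M (q + 2) q) {X : Finset α}
    (hsub : gr M \ B ⊆ X) (hX : M.eRk (X : Set α) ≤ ((q + 1 : ℕ) : ℕ∞)) : False := by
  have h := (mem_Uq.1 hB).2.2
  have h' : M.eRk ((gr M \ B : Finset α) : Set α) ≤ ((q + 1 : ℕ) : ℕ∞) :=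
    (M.eRk_mono (by exact_mod_cast hsub)).trans hX
  rw [h] at h'
  have : q + 2 ≤ q + 1 := by exact_mod_cast h'
  omega

/-- With one ground element `w` outside `G`, the set `{w} ∪ F` has rank `≤ q + 1` for a rank-`q` flat `F`. -/
theorem eRk_union_compl_le {q : ℕ} {G : Finset α} (hd : (gr M \ G).card = 1) {F : Finset α}
    (hF : F ∈ flatsQ M q) : M.eRk (((gr M \ G) ∪ F : Finset α) : Set α) ≤ ((q + 1 : ℕ) : ℕ∞) := by
  obtain ⟨w, hw⟩ := Finset.card_eq_one.1 hd
  rw [hw, Finset.singleton_union, Finset.coe_insert]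
  calc M.eRk (insert w (F : Set α)) ≤ M.eRk (F : Set α) + 1 := M.eRk_insert_le_add_one _ _
    _ = ((q + 1 : ℕ) : ℕ∞) := by rw [(mem_flatsQ.1 hF).2.2]; push_cast; rfl

/-- **Basic facts about a member `B` whose extra set is `S`**: `Z := G ∖ cl B` satisfies `Z ∩ cl B = ∅`,
`B ⊆ cl B ⊆ G`, `S ∖ B = Z`, `B = S ∖ Z`, `G ∖ S ⊆ cl B` and `G = cl B ∪ Z`. -/
theorem extra_facts {q : ℕ} {𝒜 : Finset (Finset α)} (h𝒜 : 𝒜 ⊆ Uq M (q + 2) q) {G : Finset α}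
    {B S : Finset α} (hB : B ∈ membersIn M 𝒜 G) (hS : S = B ∪ (G \ clF M B)) :
    B ⊆ clF M B ∧ clF M B ⊆ G ∧ S \ B = G \ clF M B ∧ B = S \ (G \ clF M B) ∧ G \ S ⊆ clF M B ∧
      G \ clF M B ⊆ S := by
  have hBU : B ∈ Uq M (q + 2) q := h𝒜 (mem_membersIn.1 hB).1
  have h1 : B ⊆ clF M B := subset_clF hBU
  have h2 : clF M B ⊆ G := (mem_membersIn.1 hB).2
  have hdisj : ∀ x ∈ B, x ∉ G \ clF M B := fun x hx hx' => (Finset.mem_sdiff.1 hx').2 (h1 hx)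
  refine ⟨h1, h2, ?_, ?_, ?_, ?_⟩
  · rw [hS]
    ext x
    rw [Finset.mem_sdiff, Finset.mem_union]
    constructor
    · rintro ⟨h | h, hxB⟩
      · exact absurd h hxB
      · exact h
    · intro h
      exact ⟨Or.inr h, fun hxB => hdisj x hxB h⟩
  · rw [hS]
    ext x
    rw [Finset.mem_sdiff, Finset.mem_union]
    constructor
    · intro hxB
      exact ⟨Or.inl hxB, hdisj x hxB⟩
    · rintro ⟨h | h, hx⟩
      · exact h
      · exact absurd h hx
  · intro x hx
    rw [Finset.mem_sdiff] at hx
    by_contra hxF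
    exact hx.2 (hS ▸ Finset.mem_union_right _ (Finset.mem_sdiff.2 ⟨hx.1, hxF⟩))
  · rw [hS]
    exact Finset.subset_union_right

/-- **(L1)** A set which is the extra set of some member of `𝒜` has NO covering preimage (when one ground element
lies outside `G`): a covering preimage `B₁ = S ∖ {z₁}` would have its complement inside `{w} ∪ cl B` (if `z₁ ∈ cl B`)
or would contain `B ∪ {b}` of rank `q + 1` (if `z₁ ∉ cl B`, `b` the other element of `G ∖ cl B`). -/
theorem coverPreimages_eq_empty_of_extra {q : ℕ} {𝒜 : Finset (Finset α)} (h𝒜 : 𝒜 ⊆ Uq M (q + 2) q)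
    {G : Finset α} (hG : G ∈ flatsQ M (q + 1)) (hd : (gr M \ G).card = 1) {B S : Finset α}
    (hB : B ∈ membersIn M 𝒜 G) (hS : S ∈ extraSets M G B) : coverPreimages M 𝒜 G S = ∅ := by
  classical
  rw [mem_extraSets] at hS
  obtain ⟨hcard, hSeq⟩ := hS
  obtain ⟨hBF, hFG, hSB, hBS, hGS, hZS⟩ := extra_facts h𝒜 hB hSeq
  have hBU : B ∈ Uq M (q + 2) q := h𝒜 (mem_membersIn.1 hB).1
  have hFq : clF M B ∈ flatsQ M q := clF_mem_flatsQ hBU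
  have hGg : G ⊆ gr M := (mem_flatsQ.1 hG).1
  rw [Finset.eq_empty_iff_forall_notMem]
  intro B₁ hB₁
  rw [mem_coverPreimages] at hB₁
  obtain ⟨hB₁m, hB₁c⟩ := hB₁
  rw [mem_coverSets] at hB₁c
  obtain ⟨z₁, hz₁, hz₁S⟩ := hB₁c
  rw [Finset.mem_sdiff] at hz₁
  have hB₁U : B₁ ∈ Uq M (q + 2) q := h𝒜 (mem_membersIn.1 hB₁m).1
  have hz₁B₁ : z₁ ∉ B₁ := notMem_of_notMem_clF hB₁U hz₁.2
  by_cases hz₁F : z₁ ∈ clF M B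
  · -- E ∖ B₁ ⊆ (E ∖ G) ∪ cl B
    apply false_of_compl_subset hB₁U (X := (gr M \ G) ∪ clF M B) ?_ (eRk_union_compl_le hd hFq)
    intro x hx
    rw [Finset.mem_sdiff] at hx
    rw [Finset.mem_union]
    by_cases hxG : x ∈ G
    · right
      by_contra hxF
      have hxS : x ∈ S := hZS (Finset.mem_sdiff.2 ⟨hxG, hxF⟩)
      rw [← hz₁S, Finset.mem_insert] at hxS
      rcases hxS with rfl | hxS
      · exact hxF hz₁F
      · exact hx.2 hxS
    · exact Or.inl (Finset.mem_sdiff.2 ⟨hx.1, hxG⟩)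
  · -- z₁ ∈ G ∖ cl B; the other element b of G ∖ cl B lies in B₁ together with B
    have hz₁Z : z₁ ∈ G \ clF M B := Finset.mem_sdiff.2 ⟨hz₁.1, hz₁F⟩
    obtain ⟨x, y, hxy, hZ⟩ := Finset.card_eq_two.1 hcard
    have hb : ∃ b ∈ G \ clF M B, b ≠ z₁ := by
      rw [hZ] at hz₁Z ⊢
      rw [Finset.mem_insert, Finset.mem_singleton] at hz₁Z
      rcases hz₁Z with rfl | rfl
      · exact ⟨y, by simp, hxy.symm⟩
      · exact ⟨x, by simp, hxy⟩
    obtain ⟨b, hbZ, hbz⟩ := hb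
    have hbS : b ∈ S := hZS hbZ
    have hbB₁ : b ∈ B₁ := by
      rw [← hz₁S, Finset.mem_insert] at hbS
      rcases hbS with h | h
      · exact absurd h hbz
      · exact h
    have hBB₁ : B ⊆ B₁ := by
      intro x hx
      have hxS : x ∈ S := hSeq ▸ Finset.mem_union_left _ hx
      rw [← hz₁S, Finset.mem_insert] at hxS
      rcases hxS with rfl | h
      · exact absurd (hBF hx) hz₁F
      · exact h
    have hins : insert b B ⊆ B₁ := Finset.insert_subset hbB₁ hBB₁
    have hbE : b ∈ M.E \ M.closure (B : Set α) := by
      rw [Finset.mem_sdiff] at hbZ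
      refine ⟨by rw [← coe_gr]; exact_mod_cast hGg hbZ.1, ?_⟩
      rw [← coe_clF]
      exact_mod_cast hbZ.2
    have hr1 : M.eRk ((insert b B : Finset α) : Set α) = ((q + 1 : ℕ) : ℕ∞) := by
      rw [Finset.coe_insert, Matroid.eRk_insert_eq_add_one hbE, (mem_Uq.1 hBU).2.1]
      push_cast
      rfl
    have hr2 : M.eRk ((insert b B : Finset α) : Set α) ≤ (q : ℕ∞) := by
      rw [← (mem_Uq.1 hB₁U).2.1]
      exact M.eRk_mono (by exact_mod_cast hins)
    rw [hr1] at hr2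
    have : q + 1 ≤ q := by exact_mod_cast hr2
    omega


end PercRepro.Shadow
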